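import Literature.AlgebraicGeometry.Kloosterman2025.PencilOfPairingsKernelBounds
import HarnessLib

/-!
# Kloosterman's passage to the quotient pairings (the algebraic step of Lemma 3.12)

R. Kloosterman, *On a conjecture on Hodge loci of linear combinations of linear subvarieties*,
Rend. Circ. Mat. Palermo (2) (2025), doi:10.1007/s12215-025-01307-4 = arXiv:2312.12363
[cite: Kloosterman2025, Notation 2.4, Lemma 2.9, Lemma 3.12]. Fourth file of the series
`PencilOfPairingsLeftKernel.lean` / `PencilOfPairingsKernelBounds.lean` / `PencilOfPairingsExceptionalValues.lean`;
same encoding (`B : V →ₗ[K] W →ₗ[K] K`, `ker_L = LinearMap.ker B`, `ker_R = LinearMap.ker B.flip`).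

**The printed step.** In §2.3 the pairings of Lemma 2.9 live on the QUOTIENTS
`φ_j : S/(I₁∩I₂)_α × S/(I₁∩I₂)_{t−α} → (S/I_j)_t → ℂ`, and [cite: Kloosterman2025, Lemma 3.12] (verbatim): "For
`λ ∈ ℚ*` let `I^{(λ)}` be the ideal associated to `[Y₁]+λ[Y₂]`. Then there exists an injective function
`ν : ℂ* → ℂ*` such that `T_X NL([Y₁]+λ[Y₂]) / T_X NL([Y₁],[Y₂]) = I^{(λ)}_d/(I₁∩I₂)_d = ker_L(ψ₁+ν(λ)ψ₂)`", with
(printed proof of Lemma 2.9) "The left kernel of `φ_j` equals `(I_j/I₁∩I₂)_α`" and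
`ker_R(φ₁) ⊕ ker_R(φ₂) = (S/I₁∩I₂)_{t−α}`. Abstractly: two pairings `b₁, b₂ : S × S' → K` (on the Jacobian
ring: `b_j(P,Q) = σ_j(PQ)`, `ker_L b_j = I(γ_j)_d = T_X NL(γ_j)` [cite: Kloosterman2025, Construction 3.1, Lemma 3.6])
descend to the quotients `V = S/(ker_L b₁ ∩ ker_L b₂)`, `W = S'/(ker_R b₁ ∩ ker_R b₂)`, where they satisfy the
hypotheses `V₁ ∩ V₂ = 0`, `W₁ ∩ W₂ = 0` of Notation 2.4 automatically, keep their ranks, and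
`dim ker_L(ψ₁ + cψ₂) = dim ker_L(b₁ + cb₂) − dim(ker_L b₁ ∩ ker_L b₂)` (the excess) for every `c`.

**What this file proves** (sorry-free, any field): `quotientPairing` (descending a pairing along subspaces it
kills on either side; `quotientPairing_mk`), and for the common kernels `N = ker_L b₁ ∩ ker_L b₂`,
`N' = ker_R b₁ ∩ ker_R b₂` and `ψ_j := quotientPairing b_j N N'`:
`ker_quotientPairing_eq_map` / `finrank_ker_quotientPairing_add` (`dim ker_L ψ + dim N = dim ker_L b` for any
pairing `b` killed by `N`, `N'` — applied to `b = b₁ + cb₂` this is the excess identity,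
`finrank_ker_pencil_quotient_add`), `finrank_range_quotientPairing` (`rank ψ_j = rank b_j`),
`ker_quotient_inf_eq_bot` / `ker_quotient_flip_inf_eq_bot` (Notation 2.4's disjointness holds on the
quotients). Consequently the quotient-level bound `finrank_leftKernel_add_smul_le` of the previous file and its
'before the quotient' form `finrank_leftKernel_add_smul_add_le_finrank_inf_add` are the same statement. The
ideals, `ν(λ)` (a normalisation of the `σ_j`) and the Hodge loci are NOT formalised.
-/

namespace Literature.AlgebraicGeometry.Kloosterman2025

open Module

variable {K : Type*} [Field K] {V W : Type*} [AddCommGroup V] [Module K V] [AddCommGroup W] [Module K W]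

section Descend

/-- **Descending a pairing to quotients** ("`φ_j : S/(I₁∩I₂)_α × S/(I₁∩I₂)_{t−α} → (S/I_j)_t → ℂ`"): a pairing
`b : V × W → K` that kills `N ≤ V` on the left and `N' ≤ W` on the right induces a pairing of `V/N` with `W/N'`.
[cite: Kloosterman2025, Lemma 2.9 (setting), Lemma 3.12] -/
def quotientPairing (B : V →ₗ[K] W →ₗ[K] K) (N : Submodule K V) (N' : Submodule K W)
    (hN : N ≤ LinearMap.ker B) (hN' : N' ≤ LinearMap.ker B.flip) :
    (V ⧸ N) →ₗ[K] (W ⧸ N') →ₗ[K] K :=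
  N.liftQ (N'.liftQ B.flip hN').flip (by
    intro v hv
    rw [LinearMap.mem_ker]
    refine Submodule.linearMap_qext _ (LinearMap.ext fun w => ?_)
    have hBv : B v = 0 := LinearMap.mem_ker.mp (hN hv)
    simp only [LinearMap.coe_comp, Function.comp_apply, Submodule.mkQ_apply, LinearMap.flip_apply,
      Submodule.liftQ_apply, LinearMap.zero_comp, LinearMap.zero_apply]
    rw [hBv, LinearMap.zero_apply])

/-- On representatives the descended pairing is the original one. [cite: Kloosterman2025, Lemma 3.12] -/
@[simp] theorem quotientPairing_mk (B : V →ₗ[K] W →ₗ[K] K) (N : Submodule K V) (N' : Submodule K W)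
    (hN : N ≤ LinearMap.ker B) (hN' : N' ≤ LinearMap.ker B.flip) (v : V) (w : W) :
    quotientPairing B N N' hN hN' (Submodule.Quotient.mk v) (Submodule.Quotient.mk w) = B v w := by
  simp only [quotientPairing, Submodule.liftQ_apply, LinearMap.flip_apply]

/-- The left kernel of the descended pairing is the image of the left kernel:
`ker_L ψ = (ker_L b)/N` ("The left kernel of `φ_j` equals `(I_j/I₁∩I₂)_α`"). [cite: Kloosterman2025, Lemma 2.9 (proof)] -/
theorem ker_quotientPairing_eq_map (B : V →ₗ[K] W →ₗ[K] K) (N : Submodule K V) (N' : Submodule K W)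
    (hN : N ≤ LinearMap.ker B) (hN' : N' ≤ LinearMap.ker B.flip) :
    LinearMap.ker (quotientPairing B N N' hN hN') = (LinearMap.ker B).map N.mkQ := by
  unfold quotientPairing
  rw [Submodule.ker_liftQ]
  congr 1
  ext v
  rw [LinearMap.mem_ker, LinearMap.mem_ker]
  constructor
  · intro h
    ext w
    have hw := LinearMap.congr_fun h (Submodule.Quotient.mk w)
    simpa [Submodule.liftQ_apply] using hw
  · intro h
    refine Submodule.linearMap_qext _ (LinearMap.ext fun w => ?_)
    simp only [LinearMap.coe_comp, Function.comp_apply, Submodule.mkQ_apply, LinearMap.flip_apply,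
      Submodule.liftQ_apply, LinearMap.zero_comp, LinearMap.zero_apply]
    rw [h, LinearMap.zero_apply]

/-- Dimension form: `dim ker_L ψ + dim N = dim ker_L b` (finite-dimensional `V`).
[cite: Kloosterman2025, Lemma 2.9 (proof), Lemma 3.12] -/
theorem finrank_ker_quotientPairing_add [FiniteDimensional K V] (B : V →ₗ[K] W →ₗ[K] K) (N : Submodule K V)
    (N' : Submodule K W) (hN : N ≤ LinearMap.ker B) (hN' : N' ≤ LinearMap.ker B.flip) :
    finrank K (LinearMap.ker (quotientPairing B N N' hN hN')) + finrank K N =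
      finrank K (LinearMap.ker B) := by
  rw [ker_quotientPairing_eq_map]
  -- `(ker b).map mkQ = range (mkQ ∘ subtype)`, whose kernel is `N` viewed inside `ker b`
  set U := LinearMap.ker B with hU
  have hmap : U.map N.mkQ = LinearMap.range (N.mkQ ∘ₗ U.subtype) := by
    rw [LinearMap.range_comp, Submodule.range_subtype]
  have hker : LinearMap.ker (N.mkQ ∘ₗ U.subtype) = N.comap U.subtype := by
    rw [LinearMap.ker_comp, Submodule.ker_mkQ]
  have hrn := LinearMap.finrank_range_add_finrank_ker (N.mkQ ∘ₗ U.subtype)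
  rw [← hmap, hker, (Submodule.comapSubtypeEquivOfLe hN).finrank_eq] at hrn
  omega

/-- The descended pairing has the same rank: `rank ψ_j = rank b_j` ("the rank of `φ_j` equals `h_{I_j}(α)`").
[cite: Kloosterman2025, Lemma 2.9 (proof)] -/
theorem finrank_range_quotientPairing [FiniteDimensional K V] (B : V →ₗ[K] W →ₗ[K] K) (N : Submodule K V)
    (N' : Submodule K W) (hN : N ≤ LinearMap.ker B) (hN' : N' ≤ LinearMap.ker B.flip) :
    finrank K (LinearMap.range (quotientPairing B N N' hN hN')) = finrank K (LinearMap.range B) := by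
  have h1 := LinearMap.finrank_range_add_finrank_ker (quotientPairing B N N' hN hN')
  have h2 := finrank_ker_quotientPairing_add B N N' hN hN'
  have h3 := LinearMap.finrank_range_add_finrank_ker B
  have h4 := N.finrank_quotient_add_finrank
  omega

end Descend

section CommonKernels

/-- `ker_L b₁ ∩ ker_L b₂ ≤ ker_L(b₁ + cb₂)` (the tangent-level "obvious inclusion"). [folklore] -/
private theorem inf_ker_le_ker_pencil (B₁ B₂ : V →ₗ[K] W →ₗ[K] K) (c : K) :
    LinearMap.ker B₁ ⊓ LinearMap.ker B₂ ≤ LinearMap.ker (B₁ + c • B₂) := by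
  intro v hv
  obtain ⟨h1, h2⟩ := Submodule.mem_inf.mp hv
  rw [LinearMap.mem_ker] at h1 h2 ⊢
  simp [h1, h2]

/-- `ker_R b₁ ∩ ker_R b₂ ≤ ker_R(b₁ + cb₂)`. [folklore] -/
private theorem inf_ker_flip_le_ker_pencil_flip (B₁ B₂ : V →ₗ[K] W →ₗ[K] K) (c : K) :
    LinearMap.ker B₁.flip ⊓ LinearMap.ker B₂.flip ≤ LinearMap.ker (B₁ + c • B₂).flip := by
  intro w hw
  obtain ⟨h1, h2⟩ := Submodule.mem_inf.mp hw
  refine (mem_ker_flip_iff _ w).mpr fun v => ?_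
  have a : B₁ v w = 0 := (mem_ker_flip_iff B₁ w).mp h1 v
  have b : B₂ v w = 0 := (mem_ker_flip_iff B₂ w).mp h2 v
  simp [a, b]

variable (B₁ B₂ : V →ₗ[K] W →ₗ[K] K)

/-- `ψ₁`: `b₁` descended along the common kernels `N = ker_L b₁ ∩ ker_L b₂`, `N' = ker_R b₁ ∩ ker_R b₂`
(`V = S/(I₁∩I₂)_α`, `W = S/(I₁∩I₂)_{t−α}`). [cite: Kloosterman2025, Lemma 2.9 (setting), Lemma 3.12] -/
def quotient₁ : (V ⧸ (LinearMap.ker B₁ ⊓ LinearMap.ker B₂)) →ₗ[K]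
    (W ⧸ (LinearMap.ker B₁.flip ⊓ LinearMap.ker B₂.flip)) →ₗ[K] K :=
  quotientPairing B₁ _ _ inf_le_left inf_le_left

/-- `ψ₂`: `b₂` descended along the common kernels. [cite: Kloosterman2025, Lemma 2.9 (setting), Lemma 3.12] -/
def quotient₂ : (V ⧸ (LinearMap.ker B₁ ⊓ LinearMap.ker B₂)) →ₗ[K]
    (W ⧸ (LinearMap.ker B₁.flip ⊓ LinearMap.ker B₂.flip)) →ₗ[K] K :=
  quotientPairing B₂ _ _ inf_le_right inf_le_right

/-- `ψ₁` on representatives is `b₁`. [cite: Kloosterman2025, Lemma 2.9 (setting), Lemma 3.12] -/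
@[simp] theorem quotient₁_mk (v : V) (w : W) :
    quotient₁ B₁ B₂ (Submodule.Quotient.mk v) (Submodule.Quotient.mk w) = B₁ v w :=
  quotientPairing_mk _ _ _ _ _ v w

/-- `ψ₂` on representatives is `b₂`. [cite: Kloosterman2025, Lemma 2.9 (setting), Lemma 3.12] -/
@[simp] theorem quotient₂_mk (v : V) (w : W) :
    quotient₂ B₁ B₂ (Submodule.Quotient.mk v) (Submodule.Quotient.mk w) = B₂ v w :=
  quotientPairing_mk _ _ _ _ _ v w

/-- The pencil descends: `ψ₁ + cψ₂` is `b₁ + cb₂` descended along the common kernels.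
[cite: Kloosterman2025, Lemma 3.12] -/
theorem quotient_pencil_eq (c : K) :
    quotient₁ B₁ B₂ + c • quotient₂ B₁ B₂ =
      quotientPairing (B₁ + c • B₂) (LinearMap.ker B₁ ⊓ LinearMap.ker B₂)
        (LinearMap.ker B₁.flip ⊓ LinearMap.ker B₂.flip)
        (inf_ker_le_ker_pencil B₁ B₂ c) (inf_ker_flip_le_ker_pencil_flip B₁ B₂ c) := by
  refine Submodule.linearMap_qext _ (LinearMap.ext fun v => ?_)
  refine Submodule.linearMap_qext _ (LinearMap.ext fun w => ?_)
  simp [quotientPairing_mk]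

/-- **The excess identity** of Lemma 3.12's algebraic step: for every `c`,
`dim ker_L(ψ₁ + cψ₂) + dim(ker_L b₁ ∩ ker_L b₂) = dim ker_L(b₁ + cb₂)`
("`T_X NL([Y₁]+λ[Y₂]) / T_X NL([Y₁],[Y₂]) = ker_L(ψ₁+ν(λ)ψ₂)`"). [cite: Kloosterman2025, Lemma 3.12] -/
theorem finrank_ker_pencil_quotient_add [FiniteDimensional K V] (c : K) :
    finrank K (LinearMap.ker (quotient₁ B₁ B₂ + c • quotient₂ B₁ B₂)) +
        finrank K ↥(LinearMap.ker B₁ ⊓ LinearMap.ker B₂) =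
      finrank K (LinearMap.ker (B₁ + c • B₂)) := by
  rw [quotient_pencil_eq]
  exact finrank_ker_quotientPairing_add _ _ _ _ _

/-- `rank ψ_j = rank b_j = r_j`. [cite: Kloosterman2025, Lemma 2.9 (proof), Notation 2.4] -/
theorem finrank_range_quotient [FiniteDimensional K V] :
    finrank K (LinearMap.range (quotient₁ B₁ B₂)) = finrank K (LinearMap.range B₁) ∧
      finrank K (LinearMap.range (quotient₂ B₁ B₂)) = finrank K (LinearMap.range B₂) :=
  ⟨finrank_range_quotientPairing _ _ _ _ _, finrank_range_quotientPairing _ _ _ _ _⟩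

/-- On the quotients the left kernels meet in `0` (`V₁ ∩ V₂ = 0` of Notation 2.4 holds automatically).
[cite: Kloosterman2025, Notation 2.4, Lemma 3.12] -/
theorem ker_quotient_inf_eq_bot :
    LinearMap.ker (quotient₁ B₁ B₂) ⊓ LinearMap.ker (quotient₂ B₁ B₂) = ⊥ := by
  refine (Submodule.eq_bot_iff _).mpr ?_
  intro x hx
  obtain ⟨v, rfl⟩ := Submodule.mkQ_surjective _ x
  obtain ⟨h1, h2⟩ := Submodule.mem_inf.mp hx
  rw [Submodule.mkQ_apply, Submodule.Quotient.mk_eq_zero]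
  refine Submodule.mem_inf.mpr ⟨(mem_ker_iff_forall B₁ v).mpr fun w => ?_,
    (mem_ker_iff_forall B₂ v).mpr fun w => ?_⟩
  · have h := (mem_ker_iff_forall _ _).mp h1 (Submodule.Quotient.mk w)
    simpa using h
  · have h := (mem_ker_iff_forall _ _).mp h2 (Submodule.Quotient.mk w)
    simpa using h

/-- On the quotients the right kernels meet in `0` (`W₁ ∩ W₂ = 0`). [cite: Kloosterman2025, Notation 2.4, Lemma 3.12] -/
theorem ker_quotient_flip_inf_eq_bot :
    LinearMap.ker (quotient₁ B₁ B₂).flip ⊓ LinearMap.ker (quotient₂ B₁ B₂).flip = ⊥ := by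
  refine (Submodule.eq_bot_iff _).mpr ?_
  intro y hy
  obtain ⟨w, rfl⟩ := Submodule.mkQ_surjective _ y
  obtain ⟨h1, h2⟩ := Submodule.mem_inf.mp hy
  rw [Submodule.mkQ_apply, Submodule.Quotient.mk_eq_zero]
  refine Submodule.mem_inf.mpr ⟨(mem_ker_flip_iff B₁ w).mpr fun v => ?_,
    (mem_ker_flip_iff B₂ w).mpr fun v => ?_⟩
  · have h := (mem_ker_flip_iff _ _).mp h1 (Submodule.Quotient.mk v)
    simpa using h
  · have h := (mem_ker_flip_iff _ _).mp h2 (Submodule.Quotient.mk v)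
    simpa using h

end CommonKernels

end Literature.AlgebraicGeometry.Kloosterman2025
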